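import Literature.Algebra.Polynomial.CasasAlvero.Char31Digits
import Literature.Algebra.Polynomial.CasasAlvero.Degree5
import Literature.Algebra.Polynomial.CasasAlvero.Degree6
import Literature.Algebra.Polynomial.CasasAlvero.DigitReduction
import HarnessLib

/-!
# Casas-Alvero degrees in characteristic 31: the complete classification

Over EVERY field `K` of characteristic `31`: `CA_d(K) ⟺ d = 0 ∨ d = a·31^k` with `1 ≤ a ≤ 6`.
Ingredients: the digit reduction `CA_d ⇒ d = a·p^k ∧ CA_a` (`DigitReduction.lean`, any field); the positive digits `1, 2, 3, 4`
([GrafVonBothmerEtAl2007, Props. 2, 6]), `5` (`Degree5.lean`) and `6` (`Degree6.lean`: `31` is a GOOD prime for degree `6` —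
[CastryckLaterveerOunaies2012, Thm. 4], re-proved there by kernel-checked elimination certificates — and `CA_{6·p^k}` descends from
the algebraic closure); and a refutation of every digit `7 ≤ a ≤ 30` over every field of characteristic `31`:
`7` by the degree-7 bad-prime table; `15, 16, 19, 30` by the binomial criterion (`m = 4, 7, 4, 2`); and the nineteen digits
`8, …, 14, 17, 18, 20, …, 29` by the sparse `𝔽_31`-examples of `Char31Digits.lean` (eighteen trinomials, one tetranomial for `17`).
-/

noncomputable section

open Polynomial

namespace Literature.Algebra.Polynomial.CasasAlvero

variable (K : Type*) [Field K] [CharP K 31]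

/-- every digit `7 ≤ a < 31` fails: `¬ CA_a` over every field of characteristic `31`. [folklore] -/
theorem not_holdsInDegree_digit_of_char_thirtyOne {a : ℕ} (h7 : 7 ≤ a) (hap : a < 31) : ¬ HoldsInDegree K a := by
  haveI : Fact (Nat.Prime 31) := ⟨by norm_num⟩
  interval_cases a
  · exact not_holdsInDegree_seven_of_le K 31 (by norm_num) (by norm_num)
  · exact not_holdsInDegree_eight_of_char_31 K
  · exact not_holdsInDegree_nine_of_char_31 K
  · exact not_holdsInDegree_ten_of_char_31 K
  · exact not_holdsInDegree_eleven_of_char_31 K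
  · exact not_holdsInDegree_twelve_of_char_31 K
  · exact not_holdsInDegree_thirteen_of_char_31 K
  · exact not_holdsInDegree_fourteen_of_char_31 K
  · exact not_holdsInDegree_of_choose_modEq_one K 31 (d := 15) (m := 4) (by norm_num) (by norm_num) (by decide)
  · exact not_holdsInDegree_of_choose_modEq_one K 31 (d := 16) (m := 7) (by norm_num) (by norm_num) (by decide)
  · exact not_holdsInDegree_seventeen_of_char_31 K
  · exact not_holdsInDegree_eighteen_of_char_31 K
  · exact not_holdsInDegree_of_choose_modEq_one K 31 (d := 19) (m := 4) (by norm_num) (by norm_num) (by decide)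
  · exact not_holdsInDegree_twenty_of_char_31 K
  · exact not_holdsInDegree_twentyOne_of_char_31 K
  · exact not_holdsInDegree_twentyTwo_of_char_31 K
  · exact not_holdsInDegree_twentyThree_of_char_31 K
  · exact not_holdsInDegree_twentyFour_of_char_31 K
  · exact not_holdsInDegree_twentyFive_of_char_31 K
  · exact not_holdsInDegree_twentySix_of_char_31 K
  · exact not_holdsInDegree_twentySeven_of_char_31 K
  · exact not_holdsInDegree_twentyEight_of_char_31 K
  · exact not_holdsInDegree_twentyNine_of_char_31 K
  · exact not_holdsInDegree_of_choose_modEq_one K 31 (d := 30) (m := 2) (by norm_num) (by norm_num) (by decide)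

/-- the positive digits `1 ≤ a ≤ 5`: `CA_{a·31^k}` over every field of characteristic `31`. [cite: GrafVonBothmerEtAl2007, Props. 2, 6]
[cite: CastryckLaterveerOunaies2012, Thm. 4] -/
theorem holdsInDegree_mul_thirtyOne_pow_of_le_five {a : ℕ} (ha0 : 0 < a) (ha5 : a ≤ 5) (k : ℕ) :
    HoldsInDegree K (a * 31 ^ k) := by
  haveI : Fact (Nat.Prime 31) := ⟨by norm_num⟩
  interval_cases a
  · simpa using holdsInDegree_prime_pow_field K 31 k
  · exact holdsInDegree_two_mul_prime_pow_field K 31 k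
  · exact holdsInDegree_three_mul_prime_pow_field K 31 (by norm_num) k
  · exact holdsInDegree_mul_prime_pow_field K 31
      (holdsInDegree_of_le_four_of_charP (AlgebraicClosure K) 31 (by norm_num) le_rfl) k
  · exact holdsInDegree_five_mul_prime_pow_field K 31 (by norm_num) (by norm_num) (by norm_num) (by norm_num)
      (by norm_num) (by norm_num) (by norm_num) (by norm_num) (by norm_num) k

/-- **characteristic 31, complete**: over every field of characteristic `31`,
`CA_d ⟺ d = 0 ∨ d = a·31^k` with `1 ≤ a ≤ 6`. [cite: GrafVonBothmerEtAl2007, Props. 2, 6, 7]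
[cite: CastryckLaterveerOunaies2012, Thm. 4] -/
theorem classification_char_thirtyOne_complete (d : ℕ) :
    HoldsInDegree K d ↔ d = 0 ∨ ∃ k a : ℕ, 0 < a ∧ a ≤ 6 ∧ d = a * 31 ^ k := by
  haveI : Fact (Nat.Prime 31) := ⟨by norm_num⟩
  constructor
  · intro h
    rcases Nat.eq_zero_or_pos d with rfl | hd
    · exact Or.inl rfl
    obtain ⟨k, a, ha0, hap, rfl, ha⟩ := digit_of_holdsInDegree K 31 hd.ne' h
    refine Or.inr ⟨k, a, ha0, ?_, rfl⟩
    by_contra h6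
    exact not_holdsInDegree_digit_of_char_thirtyOne K (by omega) hap ha
  · rintro (rfl | ⟨k, a, ha0, ha6, rfl⟩)
    · exact holdsInDegree_zero K
    · rcases Nat.lt_or_ge a 6 with ha | ha
      · exact holdsInDegree_mul_thirtyOne_pow_of_le_five K ha0 (by omega) k
      · obtain rfl : a = 6 := le_antisymm ha6 ha
        exact holdsInDegree_six_mul_pow_of_char_31 K k

/-- the set of Casas-Alvero degrees `≤ 961` in characteristic `31`, explicitly. [folklore] -/
theorem holdsInDegree_iff_mem_of_le_char_thirtyOne_sq {d : ℕ} (hd : d ≤ 961) :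
    HoldsInDegree K d ↔ d ∈ ({0, 1, 2, 3, 4, 5, 6, 31, 62, 93, 124, 155, 186, 961} : Finset ℕ) := by
  rw [classification_char_thirtyOne_complete]
  constructor
  · rintro (rfl | ⟨k, a, ha0, ha6, rfl⟩)
    · decide
    · rcases k with _ | _ | _ | k
      · interval_cases a <;> decide
      · interval_cases a <;> decide
      · interval_cases a <;> simp_all
      · exfalso
        have : 31 ^ 3 ≤ a * 31 ^ (k + 1 + 1 + 1) :=
          le_trans (Nat.pow_le_pow_right (by norm_num) (by omega)) (Nat.le_mul_of_pos_left _ ha0)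
        omega
  · intro h
    simp only [Finset.mem_insert, Finset.mem_singleton] at h
    rcases h with rfl | rfl | rfl | rfl | rfl | rfl | rfl | rfl | rfl | rfl | rfl | rfl | rfl | rfl
    · exact Or.inl rfl
    · exact Or.inr ⟨0, 1, by norm_num, by norm_num, by norm_num⟩
    · exact Or.inr ⟨0, 2, by norm_num, by norm_num, by norm_num⟩
    · exact Or.inr ⟨0, 3, by norm_num, by norm_num, by norm_num⟩
    · exact Or.inr ⟨0, 4, by norm_num, by norm_num, by norm_num⟩
    · exact Or.inr ⟨0, 5, by norm_num, by norm_num, by norm_num⟩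
    · exact Or.inr ⟨0, 6, by norm_num, by norm_num, by norm_num⟩
    · exact Or.inr ⟨1, 1, by norm_num, by norm_num, by norm_num⟩
    · exact Or.inr ⟨1, 2, by norm_num, by norm_num, by norm_num⟩
    · exact Or.inr ⟨1, 3, by norm_num, by norm_num, by norm_num⟩
    · exact Or.inr ⟨1, 4, by norm_num, by norm_num, by norm_num⟩
    · exact Or.inr ⟨1, 5, by norm_num, by norm_num, by norm_num⟩
    · exact Or.inr ⟨1, 6, by norm_num, by norm_num, by norm_num⟩
    · exact Or.inr ⟨2, 1, by norm_num, by norm_num, by norm_num⟩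

end Literature.Algebra.Polynomial.CasasAlvero
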